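/-
Copyright (c) 2026. All rights reserved.
Released under Apache 2.0 license as described in the file LICENSE.
Authors: abc-iut cell, prover seat abc-iut-L4-t5 (wave 2, gen 8), adapting abc-iut-w4-d095's
`LogFrobeniusNotSimCompatArchTSOfObstruction.lean` (itself over abc-iut-w5-d097's `LogFrobeniusNotSimCompatOfObstruction.lean`
and `LogFrobeniusLogWallPlusOfObstruction.lean`) to the `⊞`-observable; statements of abc-iut-L4-t3.
-/
import Literature.AnabelianGeometry.AbsoluteAnabelian.LogFrobeniusNotSimCompatArchAllTS
import HarnessLib

/-!
# [AbsTopIII] Corollary 5.5 (iv), second sentence (`Cor55NotSimultaneouslyCompatible`): the archimedean cycle on the `⊞` side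

S. Mochizuki, *Topics in absolute anabelian geometry III: global reconstruction algorithms*, J. Math. Sci. Univ.
Tokyo 22 (2015) 939–1156 [MochizukiAbsTopIII2015]; locators = pages of the author's manuscript
(`paper:url-5493eb38cbb7`), read on the page: Cor 5.5 (iv) p. 131 (second sentence: "the telecore structure `𝔗_{An•}`
of (ii), the contact structure `ℋ_{An•}` of (ii), and the observables `S_log`, `S_log⊞` of (iii) are not simultaneously
compatible"), proof pp. 132–133 ("the incompatibility of the introduction of a single model `(Γ⃗^log_v)_□` … that maps
isomorphically … to each copy `(Γ⃗^log_v)_⋎` … entirely similar to the proofs of assertion (iv) of Corollaries 3.6,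
4.5"); Def 5.4 (v) p. 127 (the archimedean graph `k~ →(id) k~ ↠ k^× ↪ k`, every arrow of which carries an `ι⊞`,
Def 5.4 (vii) p. 128).

PROOF-ONLY companion (no new notion, no named `Prop`).  The tree's reductions of the second sentence run through the
`TS`-valued observable `S_log` (abc-iut-w5-d097 `cor55NotSimultaneouslyCompatible_of_twoPathObstruction`, nonarchimedean;
abc-iut-w4-d095 `cor55NotSimultaneouslyCompatible_of_cycleObstructionTS`, archimedean), whereas the reduction of the
`⊞`-only first sentence runs through `S_log⊞` (abc-iut-w5-d097 `cor55Incompatibility_of_cycleObstruction`).  This file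
runs the second sentence's reduction through `S_log⊞` as well: abc-iut-w5-d097's (A)(B)(C) preamble (the telecore
`𝔗_{An•}` and its contact structure `ℋ_{An•}` furnish, inside any common family `K` on `D_{An•}`, an ISOMORPHISM homotopy
for the pair `([id₁], [id₀]∘[log])`; copied from abc-iut-w4-d095's file, credited) followed by the ARCHIMEDEAN CYCLE read on
the embedded family of `S_log⊞` at `v₀` (`CompatibleInTelecorePlus`, `embPlus`):
`[id₁]·[λ⊞_sl] ~ [log]·[id₀]·[λ⊞_sl] ~(ι⊞_{ε₁}) [id₁]·[λ⊞_{ν₂}] ~(ι⊞_{ε₂}) [id₁]·[λ⊞_{νₘ}] ~(ι⊞_{ε₃}) [id₁]·[λ⊞_sl]`,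
homotopy `= 𝟙` by Def 3.5 (ii).  Consequences:
* `cor55NotSimultaneouslyCompatible_of_cycleObstructionPlus` / `…_of_archObstructionPlus` — the second sentence, for
  EVERY `TS`-datum `T`, from LITERALLY the hypothesis of the first sentence's `cor55Incompatibility_of_cycleObstruction` /
  `cor55Incompatibility_of_archObstruction` (components of the setting's own `ι⊞_{v₀,ε}`; no `TS`-datum, no `𝒩_{v₀}`);
* `cor55NotSimCompat_of_iotaPlus_spaceLink_not_surjective` — the set-theoretic criterion with a set-valued functor on
  `𝒩⊞_{v₀}` (LITERALLY the hypothesis of abc-iut-w4-d095's `cor55Incompatibility_of_iota_spaceLink_not_surjective`);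
* `cor55iv_of_archObstruction` / `cor55iv_of_iotaPlus_spaceLink_not_surjective` — ONE archimedean input, in either
  form, yields `Cor55Incompatibility ∧ ∀ T, Cor55LogWall T ∧ Cor55NotSimultaneouslyCompatible T`: every typed sentence
  of Cor 5.5 (iv), first in both forms and second, at every `TS`-datum.
Compared with `LogFrobeniusNotSimCompatArchAllTS.lean` (criterion observed in `𝒩_{v₀}` after `𝒩⊞_{v₀} → 𝒩_{v₀}`), the
input here is observed in `𝒩⊞_{v₀}` itself — the last formal asymmetry between the two sentences at the abstract setting.

Refereed pre-IUT material; OUR kernel check of typed statements; nothing here bears on [IUTchIII] Cor. 3.12; no side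
taken; typed ≠ proved.
-/

set_option autoImplicit false

universe w u

open CategoryTheory Quiver

namespace Literature.AnabelianGeometry.AbsoluteAnabelian

namespace LogFrobeniusSetting

variable {Vmod : Type u} {isArc : Vmod → Bool} (L : LogFrobeniusSetting Vmod isArc)

/-! ## Transport helpers (abc-iut-w4-d095's, private there; copied) -/

/-- Components of heterogeneously equal natural transformations (between propositionally equal functors) are
heterogeneously equal. [folklore] -/
private theorem app_heq_of_heq_natTrans {C : Type (u + 1)} [Category.{u} C] {D : Type (u + 1)} [Category.{u} D]
    {F G F' G' : C ⥤ D} {α : F ⟶ G} {β : F' ⟶ G'} (h : HEq α β) (hF : F = F') (hG : G = G') (x : C) :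
    HEq (α.app x) (β.app x) := by
  subst hF hG
  cases h
  rfl

/-- Components of a natural transformation at propositionally equal objects are heterogeneously equal. [folklore] -/
private theorem app_heq_app {C : Type (u + 1)} [Category.{u} C] {D : Type (u + 1)} [Category.{u} D]
    {F G : C ⥤ D} (α : F ⟶ G) {x y : C} (h : x = y) : HEq (α.app x) (α.app y) := by
  subst h
  rfl

/-- Images under propositionally equal functors of heterogeneously equal morphisms. [folklore] -/
private theorem map_heq_map {C : Type (u + 1)} [Category.{u} C] {D : Type (u + 1)} [Category.{u} D]
    {F G : C ⥤ D} (hFG : F = G) {a b a' b' : C} (ha : a = a') (hb : b = b') {f : a ⟶ b} {g : a' ⟶ b'}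
    (h : HEq f g) : HEq (F.map f) (G.map g) := by
  subst hFG ha hb
  cases h
  rfl

/-- A four-term cycle identity transported along heterogeneous equalities of its terms. [folklore] -/
private theorem eq_id_of_heq_cycle {C : Type (u + 1)} [Category.{u} C] {o₀ o₁ o₂ o₃ c₀ c₁ c₂ c₃ : C}
    (h₀ : o₀ = c₀) (h₁ : o₁ = c₁) (h₂ : o₂ = c₂) (h₃ : o₃ = c₃)
    {κ₁ : o₀ ⟶ o₁} {κ₂ : o₁ ⟶ o₂} {κ₃ : o₂ ⟶ o₃} {κ₄ : o₃ ⟶ o₀}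
    {n₁ : c₀ ⟶ c₁} {n₂ : c₁ ⟶ c₂} {n₃ : c₂ ⟶ c₃} {n₄ : c₃ ⟶ c₀}
    (e₁ : HEq κ₁ n₁) (e₂ : HEq κ₂ n₂) (e₃ : HEq κ₃ n₃) (e₄ : HEq κ₄ n₄)
    (key : ((κ₁ ≫ κ₂) ≫ κ₃) ≫ κ₄ = 𝟙 _) : n₁ ≫ n₂ ≫ n₃ ≫ n₄ = 𝟙 _ := by
  subst h₀ h₁ h₂ h₃
  cases e₁; cases e₂; cases e₃; cases e₄
  simpa only [Category.assoc] using key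

/-- Components of a homotopy given by the whiskering axiom of Def 3.5 (ii) (b), read heterogeneously. [folklore] -/
private theorem heq_app_of_eq_whisker {C₁ C₂ C₃ C₄ : Type (u + 1)} [Category.{u} C₁] [Category.{u} C₂]
    [Category.{u} C₃] [Category.{u} C₄] {F : C₁ ⥤ C₂} {P Q : C₂ ⥤ C₃} {G : C₃ ⥤ C₄} {A B : C₁ ⥤ C₄}
    (η : P ⟶ Q) {θ : A ⟶ B} {E : A = F ⋙ (P ⋙ G)} {E' : F ⋙ (Q ⋙ G) = B}
    (W : θ = eqToHom E ≫ Functor.whiskerLeft F (Functor.whiskerRight η G) ≫ eqToHom E') (x : C₁) :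
    HEq (θ.app x) (G.map (η.app (F.obj x))) := by
  subst E E' W
  rw [eqToHom_refl, eqToHom_refl, Category.id_comp, Category.comp_id]
  rfl

/-- Transport of `IsIso` along a heterogeneous equality of morphisms with propositionally equal endpoints. [folklore] -/
private theorem isIso_of_heq_hom {C : Type*} [Category C] {a b a' b' : C} (ha : a = a') (hb : b = b')
    {f : a ⟶ b} {g : a' ⟶ b'} (h : HEq f g) (hf : IsIso f) : IsIso g := by
  subst ha hb
  cases h
  exact hf

/-- In a family of homotopies, the homotopy of a pair whose swap is also a boundary pair is an isomorphism.
[cite: MochizukiAbsTopIII2015, Definition 3.5 (ii) p.75] -/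
private theorem isIso_η_of_mem_swap {V : Type u} [Quiver.{u} V] {D : DiagramOfCategories.{u, u + 1, u} V}
    (K : D.HomotopyFamily) {a b : V} {p q : Path a b} (h : K.E p q) (h' : K.E q p) : IsIso (K.η h) := by
  refine ⟨K.η h', ?_, ?_⟩
  · rw [← K.η_trans h h', K.η_refl]
  · rw [← K.η_trans h' h, K.η_refl]

/-! ## The reduction through `S_log⊞` -/

/-- **[AbsTopIII] Cor 5.5 (iv), second sentence (`Cor55NotSimultaneouslyCompatible T`, for any `TS`-datum `T`), REDUCED to
the component-level CYCLE obstruction on the `⊞` side at one place** — data and hypothesis LITERALLY those of the first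
sentence's `cor55Incompatibility_of_cycleObstruction` (abc-iut-w5-d097): `ι⊞`-carrying edges `ε₁ : postLog → ν₂`,
`ε₂ : ν₂ → νₘ`, `ε₃ : νₘ → spaceLink` of `Γ⃗^⋉_{v₀}` (archimedean: `k~ →(id) k~ ↠ k^× ↪ k`) and "for no isomorphism
`a : x₀ ⥲ log(x₀)` is `λ⊞_sl(a) ≫ ι⊞_{ε₁} ≫ ι⊞_{ε₂} ≫ ι⊞_{ε₃}` the identity".  The telecore `𝔗_{An•}` and its contact
structure `ℋ_{An•}` replace the core of the first sentence (abc-iut-w5-d097's (A)(B)(C)); the embedded family of `S_log⊞`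
at `v₀` supplies the `ι⊞`-homotopies. [cite: MochizukiAbsTopIII2015, Cor 5.5 (iv) p. 131] -/
theorem cor55NotSimultaneouslyCompatible_of_cycleObstructionPlus (T : L.TSHomotopies) (v₀ : Vmod)
    (ν₂ νₘ : LogVertex (isArc v₀)) (h₂ : ν₂.isPostLog = false) (hₘ : νₘ.isPostLog = false)
    (ε₁ : LogEdge (isArc v₀) (LogVertex.postLog (isArc v₀)) ν₂) (ε₂ : LogEdge (isArc v₀) ν₂ νₘ)
    (ε₃ : LogEdge (isArc v₀) νₘ (LogVertex.spaceLink (isArc v₀))) (x₀ : L.X)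
    (obstruction : ∀ (a : x₀ ⟶ L.log.obj x₀), IsIso a →
      ∀ (m₁ : (L.lam v₀ (LogVertex.spaceLink (isArc v₀))).obj (L.log.obj x₀) ⟶ (L.lam v₀ ν₂).obj x₀)
        (m₂ : (L.lam v₀ ν₂).obj x₀ ⟶ (L.lam v₀ νₘ).obj x₀)
        (m₃ : (L.lam v₀ νₘ).obj x₀ ⟶ (L.lam v₀ (LogVertex.spaceLink (isArc v₀))).obj x₀),
        HEq m₁ ((L.iota v₀ ε₁).app x₀) → HEq m₂ ((L.iota v₀ ε₂).app x₀) → HEq m₃ ((L.iota v₀ ε₃).app x₀) →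
          (L.lam v₀ (LogVertex.spaceLink (isArc v₀))).map a ≫ m₁ ≫ m₂ ≫ m₃ ≠ 𝟙 _) :
    L.Cor55NotSimultaneouslyCompatible T := by
  rintro ⟨H, hH, hcore, Tl, hJ, -, Hc, Hplus, Hts, K, -, hgen, hobsAll, hJK, hHcK, hcompat⟩
  obtain ⟨-, hpre, hpost⟩ := (hobsAll v₀).1
  have hplK := (hcompat v₀).1
  have hsl : (LogVertex.spaceLink (isArc v₀)).isPostLog = false := spaceLink_isPostLog _
  have hpl : (LogVertex.postLog (isArc v₀)).isPostLog = true := by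
    generalize isArc v₀ = b; cases b <;> rfl
  /- (0) notation (abc-iut-w5-d097): the telecore shape `Γ⃗_{D_{An•}}`, its diagram, a telecore edge `φ_□`, the contact
  generator data -/
  let Sh : ExtShape.{u} (DSub (InFive (isArc := isArc))) := anTelecoreShape Tl.J
  let Dtel := L.anTelecoreDiagram Tl.J Tl.telMap
  have hJc : Tl.J ⟨.core, core_mem_five⟩ = PUnit.{u + 1} := by
    rw [hJ]; rfl
  obtain ⟨jc⟩ : Nonempty (Tl.J ⟨.core, core_mem_five⟩) := by
    rw [hJc]; exact ⟨PUnit.unit⟩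
  obtain ⟨vc, νc', hνc', vr, νr, hνr, hgenBy, -, -, -⟩ := hgen
  let b1 : Sh.Vertex := Sh.base ⟨.row1 (0 + 1), row1_mem_five (0 + 1)⟩
  let b0 : Sh.Vertex := Sh.base ⟨.row1 0, row1_mem_five 0⟩
  let bc : Sh.Vertex := Sh.base ⟨.core, core_mem_five⟩
  let eId1 : b1 ⟶ bc := show Sh.base ⟨.row1 (0 + 1), row1_mem_five (0 + 1)⟩ ⟶ Sh.base ⟨.core, core_mem_five⟩
    from DEdge.toCore (0 + 1)
  let eLog : b1 ⟶ b0 := show Sh.base ⟨.row1 (0 + 1), row1_mem_five (0 + 1)⟩ ⟶ Sh.base ⟨.row1 0, row1_mem_five 0⟩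
    from DEdge.log 0
  let eId0 : b0 ⟶ bc := show Sh.base ⟨.row1 0, row1_mem_five 0⟩ ⟶ Sh.base ⟨.core, core_mem_five⟩
    from DEdge.toCore 0
  let pId1 : Path b1 bc := (Path.nil : Path b1 b1).cons eId1
  let pLog : Path b1 bc := ((Path.nil : Path b1 b1).cons eLog).cons eId0
  let pDesc : Path bc Sh.obs := descendPath Tl.J vc νc' hνc'
  let pBeta : Path bc bc := betaCorePath Tl.J vc νc' hνc' jc
  /- (1) the telecore/contact homotopy for `([id_1], [id_0]∘[log])`, an isomorphism in `K` (abc-iut-w5-d097's (A)(B)(C)) -/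
  have hA : Hc.E (Path.nil : Path bc bc) pBeta :=
    (hgenBy _ _).mpr (Saturation.base (Or.inr (Or.inl ⟨jc, rfl, rfl, Or.inr ⟨HEq.rfl, HEq.rfl⟩⟩)))
  have hC : Hc.E pBeta (Path.nil : Path bc bc) :=
    (hgenBy _ _).mpr (Saturation.base (Or.inr (Or.inl ⟨jc, rfl, rfl, Or.inl ⟨HEq.rfl, HEq.rfl⟩⟩)))
  obtain ⟨kA, -⟩ := hHcK _ _ hA
  obtain ⟨kC, -⟩ := hHcK _ _ hC
  let X₅ : ExtShape.{u} (DSub (InFive (isArc := isArc))) := obsShape (InFive (isArc := isArc)) DVertex.an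
  let c1 : X₅.Vertex := X₅.base ⟨.row1 (0 + 1), row1_mem_five (0 + 1)⟩
  let c0 : X₅.Vertex := X₅.base ⟨.row1 0, row1_mem_five 0⟩
  let cc : X₅.Vertex := X₅.base ⟨.core, core_mem_five⟩
  let cDesc : Path cc X₅.obs :=
    ((((Path.nil : Path cc cc).cons
      (show X₅.base ⟨.core, core_mem_five⟩ ⟶ X₅.base ⟨.nplus vc, nplus_mem_five vc⟩ from DEdge.lam vc νc' hνc')).cons
      (show X₅.base ⟨.nplus vc, nplus_mem_five vc⟩ ⟶ X₅.base ⟨.nv vc, nv_mem_five vc⟩ from DEdge.forget vc)).cons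
      (show X₅.base ⟨.nv vc, nv_mem_five vc⟩ ⟶ X₅.base ⟨.e5, e5_mem_five⟩ from DEdge.toE vc)).cons
      (show X₅.base ⟨.e5, e5_mem_five⟩ ⟶ X₅.obs from DEdge.κAn)
  let q1 : Path c1 X₅.obs :=
    ((Path.nil : Path c1 c1).cons
      (show X₅.base ⟨.row1 (0 + 1), row1_mem_five (0 + 1)⟩ ⟶ X₅.base ⟨.core, core_mem_five⟩
        from DEdge.toCore (0 + 1))).comp cDesc
  let qL : Path c1 X₅.obs :=
    (((Path.nil : Path c1 c1).cons
      (show X₅.base ⟨.row1 (0 + 1), row1_mem_five (0 + 1)⟩ ⟶ X₅.base ⟨.row1 0, row1_mem_five 0⟩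
        from DEdge.log 0)).cons
      (show X₅.base ⟨.row1 0, row1_mem_five 0⟩ ⟶ X₅.base ⟨.core, core_mem_five⟩ from DEdge.toCore 0)).comp cDesc
  have hB : Tl.Jfam.E (pId1.comp pDesc) (pLog.comp pDesc) := (Tl.restrict_E q1 qL).mp (hcore.boundary_all q1 qL)
  have hB' : Tl.Jfam.E (pLog.comp pDesc) (pId1.comp pDesc) := (Tl.restrict_E qL q1).mp (hcore.boundary_all qL q1)
  have hBφ : Tl.Jfam.E (pId1.comp pBeta) (pLog.comp pBeta) :=
    Tl.Jfam.isSaturated.postcomp hB (phiCorePath Tl.J jc)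
  have hBφ' : Tl.Jfam.E (pLog.comp pBeta) (pId1.comp pBeta) :=
    Tl.Jfam.isSaturated.postcomp hB' (phiCorePath Tl.J jc)
  obtain ⟨kB, -⟩ := hJK _ _ hBφ
  obtain ⟨kB', -⟩ := hJK _ _ hBφ'
  have k₀' : K.E pId1 pLog :=
    K.isSaturated.trans (K.isSaturated.trans (K.isSaturated.precomp kA pId1) kB) (K.isSaturated.precomp kC pLog)
  have k₀'' : K.E pLog pId1 :=
    K.isSaturated.trans (K.isSaturated.trans (K.isSaturated.precomp kA pLog) kB') (K.isSaturated.precomp kC pId1)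
  have hisoK : IsIso (K.η k₀') := isIso_η_of_mem_swap K k₀' k₀''
  /- (2) the three `ι⊞`-pins of `S_log⊞` at `v₀`, transported into `K` along `embPlus` -/
  obtain ⟨hm₁, hpin₁⟩ := hpost (LogVertex.postLog (isArc v₀)) ν₂ ε₁ hpl h₂ hsl 0
  obtain ⟨hm₂, hpin₂⟩ := hpre ν₂ νₘ ε₂ h₂ hₘ
  obtain ⟨hm₃, hpin₃⟩ := hpre νₘ (LogVertex.spaceLink (isArc v₀)) ε₃ hₘ hsl
  obtain ⟨t₁, ht₁⟩ := hplK _ _ hm₁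
  obtain ⟨t₂, ht₂⟩ := hplK _ _ hm₂
  obtain ⟨t₃, ht₃⟩ := hplK _ _ hm₃
  let bN : Sh.Vertex := Sh.base ⟨.nplus v₀, nplus_mem_five v₀⟩
  let lamP : ∀ (ν : LogVertex (isArc v₀)) (_ : ν.isPostLog = false), Path bc bN :=
    fun ν hν => (Path.nil : Path bc bc).cons
      (show Sh.base ⟨.core, core_mem_five⟩ ⟶ Sh.base ⟨.nplus v₀, nplus_mem_five v₀⟩ from DEdge.lam v₀ ν hν)
  have t₁' : K.E (pLog.comp (lamP _ hsl)) (pId1.comp (lamP ν₂ h₂)) := t₁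
  have t₂' : K.E (lamP ν₂ h₂) (lamP νₘ hₘ) := t₂
  have t₃' : K.E (lamP νₘ hₘ) (lamP _ hsl) := t₃
  /- (3) the cycle in `K`; a family assigns the IDENTITY to a pair `(γ, γ)` -/
  have s1 : K.E (pId1.comp (lamP _ hsl)) (pLog.comp (lamP _ hsl)) :=
    K.isSaturated.precomp (K.isSaturated.postcomp k₀' (lamP _ hsl)) Path.nil
  have s2 : K.E (pId1.comp (lamP ν₂ h₂)) (pId1.comp (lamP νₘ hₘ)) :=
    K.isSaturated.precomp (K.isSaturated.postcomp t₂' Path.nil) pId1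
  have s3 : K.E (pId1.comp (lamP νₘ hₘ)) (pId1.comp (lamP _ hsl)) :=
    K.isSaturated.precomp (K.isSaturated.postcomp t₃' Path.nil) pId1
  have key : ((K.η s1 ≫ K.η t₁') ≫ K.η s2) ≫ K.η s3 = 𝟙 _ := by
    rw [← K.η_trans s1 t₁', ← K.η_trans, ← K.η_trans]
    exact K.η_refl _
  have keyx : (((K.η s1).app x₀ ≫ (K.η t₁').app x₀) ≫ (K.η s2).app x₀) ≫ (K.η s3).app x₀ = 𝟙 _ := by
    have := NatTrans.congr_app key x₀
    simpa only [NatTrans.comp_app, NatTrans.id_app] using this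
  /- (4) functor identities along the explicit paths -/
  have E_nil : Dtel.pathFunctor (Path.nil : Path b1 b1) = 𝟭 L.X := DiagramOfCategories.pathFunctor_nil _ _
  have E_id1 : Dtel.pathFunctor pId1 = 𝟭 L.X := by
    simp only [pId1, DiagramOfCategories.pathFunctor_cons, DiagramOfCategories.pathFunctor_nil]; rfl
  have E_log : Dtel.pathFunctor pLog = L.log := by
    simp only [pLog, DiagramOfCategories.pathFunctor_cons, DiagramOfCategories.pathFunctor_nil]; rfl
  have Q : ∀ (ν : LogVertex (isArc v₀)) (hν : ν.isPostLog = false), Dtel.pathFunctor (lamP ν hν) = L.lam v₀ ν := by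
    intro ν hν
    simp only [lamP, DiagramOfCategories.pathFunctor_cons, DiagramOfCategories.pathFunctor_nil]; rfl
  have E1c : ∀ (ν : LogVertex (isArc v₀)) (hν : ν.isPostLog = false),
      Dtel.pathFunctor (pId1.comp (lamP ν hν)) = L.lam v₀ ν := by
    intro ν hν
    simp only [pId1, lamP, Path.comp_cons, Path.comp_nil, DiagramOfCategories.pathFunctor_cons,
      DiagramOfCategories.pathFunctor_nil]; rfl
  have ELc : ∀ (ν : LogVertex (isArc v₀)) (hν : ν.isPostLog = false),
      Dtel.pathFunctor (pLog.comp (lamP ν hν)) = L.log ⋙ L.lam v₀ ν := by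
    intro ν hν
    simp only [pLog, lamP, Path.comp_cons, Path.comp_nil, DiagramOfCategories.pathFunctor_cons,
      DiagramOfCategories.pathFunctor_nil]; rfl
  have PPl : ∀ (ν : LogVertex (isArc v₀)) (hν : ν.isPostLog = false),
      (L.logDiagramPlus v₀).pathFunctor (lamPath v₀ ν hν) = L.lam v₀ ν := by
    intro ν hν
    simp only [lamPath, lamEdge, DiagramOfCategories.pathFunctor_cons, DiagramOfCategories.pathFunctor_nil]; rfl
  have PPld : (L.logDiagramPlus v₀).pathFunctor (postLogDomPath v₀ 0 hsl) =
      L.log ⋙ L.lam v₀ (LogVertex.spaceLink (isArc v₀)) := by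
    simp only [postLogDomPath, logEdge, toCoreEdge, lamEdge, DiagramOfCategories.pathFunctor_cons,
      DiagramOfCategories.pathFunctor_nil]; rfl
  have PPlc : (L.logDiagramPlus v₀).pathFunctor (postLogCodPath v₀ 0 ν₂ h₂) = L.lam v₀ ν₂ := by
    simp only [postLogCodPath, toCoreEdge, lamEdge, DiagramOfCategories.pathFunctor_cons,
      DiagramOfCategories.pathFunctor_nil]; rfl
  /- (5) the four factors, heterogeneously -/
  have ht₁' : HEq ((Hplus v₀).η hm₁) (K.η t₁') := ht₁
  have ht₂' : HEq ((Hplus v₀).η hm₂) (K.η t₂') := ht₂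
  have ht₃' : HEq ((Hplus v₀).η hm₃) (K.η t₃') := ht₃
  have g₁ : HEq ((K.η t₁').app x₀) ((L.iota v₀ ε₁).app x₀) := by
    obtain ⟨o, o', H⟩ := hpin₁ x₀
    exact (app_heq_of_heq_natTrans ht₁' (PPld.trans (ELc _ hsl).symm) (PPlc.trans (E1c ν₂ h₂).symm) x₀).symm.trans
      ((conj_eqToHom_iff_heq' _ _ o o').mp H)
  have g₂ : ∀ y : L.X, HEq ((K.η t₂').app y) ((L.iota v₀ ε₂).app y) := fun y => by
    obtain ⟨o, o', H⟩ := hpin₂ y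
    exact (app_heq_of_heq_natTrans ht₂' ((PPl ν₂ h₂).trans (Q ν₂ h₂).symm) ((PPl νₘ hₘ).trans (Q νₘ hₘ).symm) y).symm.trans
      ((conj_eqToHom_iff_heq' _ _ o o').mp H)
  have g₃ : ∀ y : L.X, HEq ((K.η t₃').app y) ((L.iota v₀ ε₃).app y) := fun y => by
    obtain ⟨o, o', H⟩ := hpin₃ y
    exact (app_heq_of_heq_natTrans ht₃' ((PPl νₘ hₘ).trans (Q νₘ hₘ).symm) ((PPl _ hsl).trans (Q _ hsl).symm) y).symm.trans
      ((conj_eqToHom_iff_heq' _ _ o o').mp H)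
  have hx_nil : (Dtel.pathFunctor (Path.nil : Path b1 b1)).obj x₀ = x₀ := Functor.congr_obj E_nil x₀
  have hx_id1 : (Dtel.pathFunctor pId1).obj x₀ = x₀ := Functor.congr_obj E_id1 x₀
  have hx_log : (Dtel.pathFunctor pLog).obj x₀ = L.log.obj x₀ := Functor.congr_obj E_log x₀
  haveI := hisoK
  obtain ⟨a, ha⟩ : ∃ a : x₀ ⟶ L.log.obj x₀, a = eqToHom hx_id1.symm ≫ (K.η k₀').app x₀ ≫ eqToHom hx_log :=
    ⟨_, rfl⟩
  have ha_iso : IsIso a :=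
    isIso_of_heq_hom hx_id1 hx_log ((conj_eqToHom_iff_heq' _ _ hx_id1.symm hx_log).mp ha).symm inferInstance
  have ha_heq : HEq ((K.η k₀').app ((Dtel.pathFunctor (Path.nil : Path b1 b1)).obj x₀)) a :=
    (app_heq_app (K.η k₀') hx_nil).trans ((conj_eqToHom_iff_heq' _ _ hx_id1.symm hx_log).mp ha).symm
  have E_nilN : Dtel.pathFunctor (Path.nil : Path bN bN) = 𝟭 _ := DiagramOfCategories.pathFunctor_nil _ _
  have e1 : HEq ((K.η s1).app x₀) ((L.lam v₀ (LogVertex.spaceLink (isArc v₀))).map a) :=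
    (heq_app_of_eq_whisker (K.η k₀') (K.η_whisker k₀' Path.nil (lamP _ hsl)) x₀).trans
      (map_heq_map (Q _ hsl) ((Functor.congr_obj E_id1 _).trans hx_nil)
        ((Functor.congr_obj E_log _).trans (congrArg L.log.obj hx_nil)) ha_heq)
  have e2 : HEq ((K.η s2).app x₀) ((L.iota v₀ ε₂).app x₀) :=
    (heq_app_of_eq_whisker (K.η t₂') (K.η_whisker t₂' pId1 Path.nil) x₀).trans
      (map_heq_map E_nilN (by rw [Functor.congr_obj (Q ν₂ h₂), hx_id1, h₂]; rfl)
        (by rw [Functor.congr_obj (Q νₘ hₘ), hx_id1]) ((app_heq_app (K.η t₂') hx_id1).trans (g₂ _)))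
  have e3 : HEq ((K.η s3).app x₀) ((L.iota v₀ ε₃).app x₀) :=
    (heq_app_of_eq_whisker (K.η t₃') (K.η_whisker t₃' pId1 Path.nil) x₀).trans
      (map_heq_map E_nilN (by rw [Functor.congr_obj (Q νₘ hₘ), hx_id1, hₘ]; rfl)
        (by rw [Functor.congr_obj (Q _ hsl), hx_id1]) ((app_heq_app (K.η t₃') hx_id1).trans (g₃ _)))
  /- (6) "writing out explicitly the meaning" of `ζ = id` at `x₀` -/
  have h₀ : (Dtel.pathFunctor (pId1.comp (lamP _ hsl))).obj x₀ =
      (L.lam v₀ (LogVertex.spaceLink (isArc v₀))).obj x₀ := Functor.congr_obj (E1c _ hsl) x₀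
  have h₁ : (Dtel.pathFunctor (pLog.comp (lamP _ hsl))).obj x₀ =
      (L.lam v₀ (LogVertex.spaceLink (isArc v₀))).obj (L.log.obj x₀) :=
    Functor.congr_obj (ELc _ hsl) x₀
  have h₂' : (Dtel.pathFunctor (pId1.comp (lamP ν₂ h₂))).obj x₀ = (L.lam v₀ ν₂).obj x₀ :=
    Functor.congr_obj (E1c ν₂ h₂) x₀
  have h₃' : (Dtel.pathFunctor (pId1.comp (lamP νₘ hₘ))).obj x₀ = (L.lam v₀ νₘ).obj x₀ :=
    Functor.congr_obj (E1c νₘ hₘ) x₀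
  obtain ⟨m₁, hm₁⟩ : ∃ m₁ : (L.lam v₀ (LogVertex.spaceLink (isArc v₀))).obj (L.log.obj x₀) ⟶ (L.lam v₀ ν₂).obj x₀,
      m₁ = eqToHom h₁.symm ≫ (K.η t₁').app x₀ ≫ eqToHom h₂' := ⟨_, rfl⟩
  obtain ⟨m₂, hm₂⟩ : ∃ m₂ : (L.lam v₀ ν₂).obj x₀ ⟶ (L.lam v₀ νₘ).obj x₀,
      m₂ = eqToHom h₂'.symm ≫ (K.η s2).app x₀ ≫ eqToHom h₃' := ⟨_, rfl⟩
  obtain ⟨m₃, hm₃⟩ : ∃ m₃ : (L.lam v₀ νₘ).obj x₀ ⟶ (L.lam v₀ (LogVertex.spaceLink (isArc v₀))).obj x₀,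
      m₃ = eqToHom h₃'.symm ≫ (K.η s3).app x₀ ≫ eqToHom h₀ := ⟨_, rfl⟩
  have c₁ : HEq ((K.η t₁').app x₀) m₁ := ((conj_eqToHom_iff_heq' _ _ h₁.symm h₂').mp hm₁).symm
  have c₂ : HEq ((K.η s2).app x₀) m₂ := ((conj_eqToHom_iff_heq' _ _ h₂'.symm h₃').mp hm₂).symm
  have c₃ : HEq ((K.η s3).app x₀) m₃ := ((conj_eqToHom_iff_heq' _ _ h₃'.symm h₀).mp hm₃).symm
  exact obstruction a ha_iso m₁ m₂ m₃ (c₁.symm.trans g₁) (c₂.symm.trans e2) (c₃.symm.trans e3)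
    (eq_id_of_heq_cycle h₀ h₁ h₂' h₃' e1 c₁ c₂ c₃ keyx)

/-- **[AbsTopIII] Cor 5.5 (iv), second sentence, for EVERY `TS`-datum, from the ARCHIMEDEAN cycle obstruction on the `⊞`
side** at one archimedean place `v₀` — hypothesis LITERALLY that of the first sentence's
`cor55Incompatibility_of_archObstruction`. [cite: MochizukiAbsTopIII2015, Cor 5.5 (iv) p. 131] -/
theorem cor55NotSimultaneouslyCompatible_of_archObstructionPlus (T : L.TSHomotopies) (v₀ : Vmod)
    (hv₀ : isArc v₀ = true) (x₀ : L.X)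
    (obstruction : ∀ (ν₂ νₘ : LogVertex (isArc v₀)) (_ : ν₂.isPostLog = false) (_ : νₘ.isPostLog = false)
      (ε₁ : LogEdge (isArc v₀) (LogVertex.postLog (isArc v₀)) ν₂) (ε₂ : LogEdge (isArc v₀) ν₂ νₘ)
      (ε₃ : LogEdge (isArc v₀) νₘ (LogVertex.spaceLink (isArc v₀))) (a : x₀ ⟶ L.log.obj x₀), IsIso a →
      ∀ (m₁ : (L.lam v₀ (LogVertex.spaceLink (isArc v₀))).obj (L.log.obj x₀) ⟶ (L.lam v₀ ν₂).obj x₀)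
        (m₂ : (L.lam v₀ ν₂).obj x₀ ⟶ (L.lam v₀ νₘ).obj x₀)
        (m₃ : (L.lam v₀ νₘ).obj x₀ ⟶ (L.lam v₀ (LogVertex.spaceLink (isArc v₀))).obj x₀),
        HEq m₁ ((L.iota v₀ ε₁).app x₀) → HEq m₂ ((L.iota v₀ ε₂).app x₀) → HEq m₃ ((L.iota v₀ ε₃).app x₀) →
          (L.lam v₀ (LogVertex.spaceLink (isArc v₀))).map a ≫ m₁ ≫ m₂ ≫ m₃ ≠ 𝟙 _) :
    L.Cor55NotSimultaneouslyCompatible T := by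
  obtain ⟨ν₂, νₘ, h₂, hₘ, ⟨ε₁⟩, ⟨ε₂⟩, ⟨ε₃⟩⟩ := exists_logCycle_of_eq_true (isArc v₀) hv₀
  exact L.cor55NotSimultaneouslyCompatible_of_cycleObstructionPlus T v₀ ν₂ νₘ h₂ hₘ ε₁ ε₂ ε₃ x₀
    (obstruction ν₂ νₘ h₂ hₘ ε₁ ε₂ ε₃)

/-- **ONE archimedean cycle obstruction yields EVERY typed sentence of [AbsTopIII] Cor 5.5 (iv)**: the `⊞`-only first
sentence (`Cor55Incompatibility`, abc-iut-w5-d097's `cor55Incompatibility_of_archObstruction`), hence the print-faithful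
first sentence at every `TS`-datum (abc-iut-L4-t3's `cor55LogWall_of_incompatibility`), and the second sentence at every
`TS`-datum (`cor55NotSimultaneouslyCompatible_of_archObstructionPlus`). [cite: MochizukiAbsTopIII2015, Cor 5.5 (iv) p. 131] -/
theorem cor55iv_of_archObstruction (v₀ : Vmod) (hv₀ : isArc v₀ = true) (x₀ : L.X)
    (obstruction : ∀ (ν₂ νₘ : LogVertex (isArc v₀)) (_ : ν₂.isPostLog = false) (_ : νₘ.isPostLog = false)
      (ε₁ : LogEdge (isArc v₀) (LogVertex.postLog (isArc v₀)) ν₂) (ε₂ : LogEdge (isArc v₀) ν₂ νₘ)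
      (ε₃ : LogEdge (isArc v₀) νₘ (LogVertex.spaceLink (isArc v₀))) (a : x₀ ⟶ L.log.obj x₀), IsIso a →
      ∀ (m₁ : (L.lam v₀ (LogVertex.spaceLink (isArc v₀))).obj (L.log.obj x₀) ⟶ (L.lam v₀ ν₂).obj x₀)
        (m₂ : (L.lam v₀ ν₂).obj x₀ ⟶ (L.lam v₀ νₘ).obj x₀)
        (m₃ : (L.lam v₀ νₘ).obj x₀ ⟶ (L.lam v₀ (LogVertex.spaceLink (isArc v₀))).obj x₀),
        HEq m₁ ((L.iota v₀ ε₁).app x₀) → HEq m₂ ((L.iota v₀ ε₂).app x₀) → HEq m₃ ((L.iota v₀ ε₃).app x₀) →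
          (L.lam v₀ (LogVertex.spaceLink (isArc v₀))).map a ≫ m₁ ≫ m₂ ≫ m₃ ≠ 𝟙 _) :
    L.Cor55Incompatibility ∧ ∀ T : L.TSHomotopies, L.Cor55LogWall T ∧ L.Cor55NotSimultaneouslyCompatible T := by
  have h₁ : L.Cor55Incompatibility := L.cor55Incompatibility_of_archObstruction v₀ hv₀ x₀ obstruction
  exact ⟨h₁, fun T => ⟨L.cor55LogWall_of_incompatibility T h₁,
    L.cor55NotSimultaneouslyCompatible_of_archObstructionPlus T v₀ hv₀ x₀ obstruction⟩⟩

/-- **[AbsTopIII] Cor 5.5 (iv), second sentence, for EVERY `TS`-datum, from the non-surjectivity of print's `k^× ↪ k`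
observed in `𝒩⊞_{v₀}`** — hypothesis LITERALLY that of abc-iut-w4-d095's `cor55Incompatibility_of_iota_spaceLink_not_surjective`
(a set-valued functor `Φ⊞` on `𝒩⊞_{v₀}` under which the `x₀`-component of `ι⊞_{v₀,ε}` along every edge into the space-link
vertex is not surjective): a composite ending in a non-surjective map is not the identity.
[cite: MochizukiAbsTopIII2015, Cor 5.5 (iv) p. 131] -/
theorem cor55NotSimCompat_of_iotaPlus_spaceLink_not_surjective (T : L.TSHomotopies) (v₀ : Vmod)
    (hv₀ : isArc v₀ = true) (x₀ : L.X) (Φ : L.Nplus v₀ ⥤ Type w)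
    (hΦ : ∀ (ν : LogVertex (isArc v₀)), ν.isPostLog = false →
      ∀ ε : LogEdge (isArc v₀) ν (LogVertex.spaceLink (isArc v₀)),
        ¬ Function.Surjective (Φ.map ((L.iota v₀ ε).app x₀) : _ → _)) :
    L.Cor55NotSimultaneouslyCompatible T := by
  refine L.cor55NotSimultaneouslyCompatible_of_archObstructionPlus T v₀ hv₀ x₀ ?_
  intro ν₂ νₘ _ hₘ ε₁ ε₂ ε₃ a _ m₁ m₂ m₃ _ _ hm₃ hcomp
  have hobj : (L.lam v₀ νₘ).obj x₀ = (frobeniusTwist L.log νₘ.isPostLog ⋙ L.lam v₀ νₘ).obj x₀ := by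
    rw [hₘ]
    rfl
  have hm₃' : m₃ = eqToHom hobj ≫ (L.iota v₀ ε₃).app x₀ ≫ eqToHom rfl :=
    (conj_eqToHom_iff_heq' m₃ ((L.iota v₀ ε₃).app x₀) hobj rfl).mpr hm₃
  have hsurj : Function.Surjective (Φ.map m₃ : _ → _) := by
    have h := congrArg Φ.map hcomp
    intro y
    refine ⟨Φ.map m₂ (Φ.map m₁ (Φ.map ((L.lam v₀ (LogVertex.spaceLink (isArc v₀))).map a) y)), ?_⟩
    have hy := CategoryTheory.congr_fun h y
    simp only [Functor.map_comp_apply, Functor.map_id_apply] at hy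
    exact hy
  rw [hm₃'] at hsurj
  simp only [eqToHom_refl, Category.comp_id, Functor.map_comp, types_comp] at hsurj
  exact hΦ νₘ hₘ ε₃ (Function.Surjective.of_comp hsurj)

/-- **ONE print-shaped archimedean input observed in `𝒩⊞_{v₀}` yields EVERY typed sentence of [AbsTopIII] Cor 5.5 (iv)**
(first sentence in both forms, second sentence, every `TS`-datum). [cite: MochizukiAbsTopIII2015, Cor 5.5 (iv) p. 131] -/
theorem cor55iv_of_iotaPlus_spaceLink_not_surjective (v₀ : Vmod) (hv₀ : isArc v₀ = true) (x₀ : L.X)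
    (Φ : L.Nplus v₀ ⥤ Type w)
    (hΦ : ∀ (ν : LogVertex (isArc v₀)), ν.isPostLog = false →
      ∀ ε : LogEdge (isArc v₀) ν (LogVertex.spaceLink (isArc v₀)),
        ¬ Function.Surjective (Φ.map ((L.iota v₀ ε).app x₀) : _ → _)) :
    L.Cor55Incompatibility ∧ ∀ T : L.TSHomotopies, L.Cor55LogWall T ∧ L.Cor55NotSimultaneouslyCompatible T := by
  have h₁ : L.Cor55Incompatibility := L.cor55Incompatibility_of_iota_spaceLink_not_surjective v₀ hv₀ x₀ Φ hΦ
  exact ⟨h₁, fun T => ⟨L.cor55LogWall_of_incompatibility T h₁,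
    L.cor55NotSimCompat_of_iotaPlus_spaceLink_not_surjective T v₀ hv₀ x₀ Φ hΦ⟩⟩

end LogFrobeniusSetting

/-! ## At the setting with genuine archimedean components: all of Cor 5.5 (iv) from the single input `k^× ↪ k ∌ 0` -/

namespace LogFrobeniusSetting

variable (𝔄 : AutHolFieldFunctor.{u})

/-- **At `archGenuine 𝔄`, over every index set with an archimedean place `v₀` and every `TF`-pair `x₀`, EVERY typed sentence
of [AbsTopIII] Cor 5.5 (iv) holds — `Cor55Incompatibility`, and `Cor55LogWall T`, `Cor55NotSimultaneouslyCompatible T` for every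
`TS`-datum `T` — from the single arithmetic input "`k^× ↪ k` misses `0`" (`forget_archIota_spaceLink_not_surjective`) read on
`S_log⊞`.**  Same conclusions as `archGenuine_cor55Incompatibility` ∧ `archGenuine_cor55iv`, here by ONE route.  MODEL-LEVEL
(module docstring of `LogFrobeniusLogWallArchOrigin.lean`). [cite: MochizukiAbsTopIII2015, Cor 5.5 (iv) p. 131] -/
theorem archGenuine_cor55iv_all (Vmod : Type (u + 1)) (isArc : Vmod → Bool) (v₀ : Vmod) (hv₀ : isArc v₀ = true)
    (x₀ : Up (HolTFPair 𝔄)) :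
    (archGenuine 𝔄 Vmod isArc).Cor55Incompatibility ∧
      ∀ T : (archGenuine 𝔄 Vmod isArc).TSHomotopies,
        (archGenuine 𝔄 Vmod isArc).Cor55LogWall T ∧ (archGenuine 𝔄 Vmod isArc).Cor55NotSimultaneouslyCompatible T :=
  (archGenuine 𝔄 Vmod isArc).cor55iv_of_iotaPlus_spaceLink_not_surjective v₀ hv₀ x₀
    (inducedFunctor _ ⋙ HolTHPair.forget 𝔄)
    (fun ν _ ε => forget_archIota_spaceLink_not_surjective 𝔄 (isArc v₀) hv₀ ν ε x₀)

end LogFrobeniusSetting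

end Literature.AnabelianGeometry.AbsoluteAnabelian
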